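import Summits.Ventures.HSemireg.ContractionRankPointPairBox
import HarnessLib

/-!
# Venture HSemireg — Künneth structure of the polyvector contraction span, V: the count with INTRINSIC factor data
# (general even factors; independence and dimensions transported from `Λ V₁`, `Λ V₂`), abstract and on the real carriers

HONEST FRAMING. Pure linear algebra + a by-value class shape, continuing `ContractionSpanKunnethBox.lean` /
`ContractionRankPointPairBox.lean` (seat p4 of the computation cell `pub-hsemireg`; statement sheet `theory/FORMULA-N-th7.md`
§N.3 / §N.5 / §N.10, theory seat 7; the GLUE asked for by the enclosure plan `lean/ENCLOSURE-PLAN-p3.md`). Nothing here is a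
claim about any explicit variety and nothing here says that HC / HC_CM / HC_AV holds. Everything is PROVED; no named fact.

CONTENT. The Künneth count `ContractionSpan.finrank_span_mul_eq` takes its hypotheses (evenness, independence of the three
factor spans) and produces its answer (factor dimensions) INSIDE `Λ V`, `V = V₁ ⊕ V₂`. This file restates everything with
INTRINSIC factor data — computed in the factor's own exterior algebra `Λ Vᵢ` with respect to `Lᵢ ∩ Vᵢ` and its annihilator
in `Vᵢ^*` — which is the form in which factor laws are proved (T_lin here; the wedge/Hankel model of theory seat 7 and its
carrier bridge, enclosed by seat p3): `map_mem_evenFactorAlg_of_mem` (intrinsically even ⇒ even in `Λ V`),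
`iSupIndep_spans_map` (intrinsic independence of `S², S¹, K x` ⇒ independence inside `Λ V`, both orderings; images under the
injective `Λ Vᵢ → Λ V`, Mathlib `LinearMap.iSupIndep_map`), `finrank_span_singleton_map_eq`, and the COUNT
`finrank_span_map_mul_map`: `dim span(Λι x₁' ∧ Λι x₂') = r₂(x₁')·r₀(x₂') + r₁(x₁')·r₁(x₂') + r₀(x₁')·r₂(x₂')` with all `rₖ`
intrinsic. On the REAL carriers (`contractionRank_box`): for an abelian variety whose `H¹ = V₁ ⊕ V₂`, `H^{0,1} = L₁ ⊕ L₂` and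
whose total class is `Λι x₁' ∧ Λι x₂'` (BY-VALUE binders, as in `ContractionRankPointPairBox.lean`), `contractionRank` is that
sum. The point-pair box (`6n² - 2n`, `18`) is the special case `xᵢ' = aᵢ + bᵢωᵢ`.

References: [BourbakiAlgebre1a3] Ch. III §7 no. 1–2, 7 and §11 no. 9; [BuchweitzFlenner2008HH] Prop. 6.4.4.
-/

noncomputable section

open CliffordAlgebra (contractLeft)
open ExteriorAlgebra (ι)
open Module

namespace Summit.Ventures.HSemireg

namespace ContractionSpan

section Factors

variable {K : Type*} [Field K] {V : Type*} [AddCommGroup V] [Module K V] {V₁ V₂ L₁ L₂ : Submodule K V}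

/-- **Intrinsically even ⇒ even in `Λ V`**: `Λι` maps `Λ^{even} V₁` (computed in `Λ V₁`, i.e. `evenFactorAlg ⊤`) into
`evenFactorAlg V₁ ⊆ Λ V`. [cite: BourbakiAlgebre1a3, Ch. III §7 no. 2] -/
theorem map_mem_evenFactorAlg_of_mem {x' : ExteriorAlgebra K V₁} (hx' : x' ∈ evenFactorAlg (⊤ : Submodule K V₁)) :
    ExteriorAlgebra.map V₁.subtype x' ∈ evenFactorAlg V₁ := by
  have h : (evenFactorAlg (⊤ : Submodule K V₁)).map (ExteriorAlgebra.map V₁.subtype) ≤ evenFactorAlg V₁ := by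
    rw [evenFactorAlg, AlgHom.map_adjoin]
    refine Algebra.adjoin_le ?_
    rintro _ ⟨_, ⟨v, -, w, -, rfl⟩, rfl⟩
    rw [map_mul, ExteriorAlgebra.map_apply_ι, ExteriorAlgebra.map_apply_ι]
    exact ι_mul_ι_mem_evenFactorAlg v.2 w.2
  exact h ⟨x', hx', rfl⟩

/-- The annihilator as a set: `↑(Ann L) = {θ | θ|_L = 0}` (the carrier bridge of theory seat 7 writes `↑L.dualAnnihilator`
where these files write the set-builder). [cite: BourbakiAlgebre1a3, Ch. II §2 no. 4] -/
theorem coe_dualAnnihilator_eq (L : Submodule K V) :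
    ((L.dualAnnihilator : Submodule K (Module.Dual K V)) : Set (Module.Dual K V)) = {θ | ∀ q ∈ L, θ q = 0} :=
  Set.ext fun θ => Submodule.mem_dualAnnihilator θ

/-- Transport of the line `K x`. [cite: BourbakiAlgebre1a3, Ch. III §7 no. 2] -/
theorem span_singleton_map_eq (x' : ExteriorAlgebra K V₁) :
    (K ∙ ExteriorAlgebra.map V₁.subtype x') = (K ∙ x').map (ExteriorAlgebra.map V₁.subtype).toLinearMap := by
  rw [Submodule.map_span, Set.image_singleton, AlgHom.toLinearMap_apply]

/-- Hence `dim K(Λι x') = dim K x'`. [cite: BourbakiAlgebre1a3, Ch. III §7 no. 2] -/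
theorem finrank_span_singleton_map_eq (x' : ExteriorAlgebra K V₁) :
    Module.finrank K (K ∙ ExteriorAlgebra.map V₁.subtype x') = Module.finrank K (K ∙ x') := by
  rw [span_singleton_map_eq]
  exact ((Submodule.equivMapOfInjective _
    (ExteriorAlgebra.map_injective_field (Submodule.ker_subtype V₁)) _).finrank_eq).symm

/-- **Transport of independence**: if the factor's three INTRINSIC spans `S²(x'), S¹(x'), K x'` (in `Λ V₁`, with respect to
`L₁ ∩ V₁` and its annihilator) are independent, so are the three spans of `Λι x'` inside `Λ V` (with respect to `L₁` and the
factor forms) — in both orderings used by `finrank_span_mul_eq`. [cite: BourbakiAlgebre1a3, Ch. III §7 no. 1–2] -/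
theorem iSupIndep_spans_map (hV : IsCompl V₁ V₂) (hL₁ : L₁ ≤ V₁) (x' : ExteriorAlgebra K V₁)
    (h : iSupIndep ![span ((L₁.comap V₁.subtype : Submodule K V₁) : Set V₁)
        {θ' : Module.Dual K V₁ | ∀ q ∈ L₁.comap V₁.subtype, θ' q = 0} x',
      span₁ ((L₁.comap V₁.subtype : Submodule K V₁) : Set V₁)
        {θ' : Module.Dual K V₁ | ∀ q ∈ L₁.comap V₁.subtype, θ' q = 0} x', K ∙ x']) :
    iSupIndep ![span (L₁ : Set V) (factorForms L₁ V₂) (ExteriorAlgebra.map V₁.subtype x'),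
        span₁ (L₁ : Set V) (factorForms L₁ V₂) (ExteriorAlgebra.map V₁.subtype x'), K ∙ ExteriorAlgebra.map V₁.subtype x'] ∧
      iSupIndep ![K ∙ ExteriorAlgebra.map V₁.subtype x', span₁ (L₁ : Set V) (factorForms L₁ V₂) (ExteriorAlgebra.map V₁.subtype x'),
        span (L₁ : Set V) (factorForms L₁ V₂) (ExteriorAlgebra.map V₁.subtype x')] := by
  have hf : Function.Injective (ExteriorAlgebra.map V₁.subtype).toLinearMap :=
    ExteriorAlgebra.map_injective_field (Submodule.ker_subtype V₁)
  have h' := LinearMap.iSupIndep_map (ExteriorAlgebra.map V₁.subtype).toLinearMap hf h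
  have e : (fun i => (![span ((L₁.comap V₁.subtype : Submodule K V₁) : Set V₁)
        {θ' : Module.Dual K V₁ | ∀ q ∈ L₁.comap V₁.subtype, θ' q = 0} x',
      span₁ ((L₁.comap V₁.subtype : Submodule K V₁) : Set V₁)
        {θ' : Module.Dual K V₁ | ∀ q ∈ L₁.comap V₁.subtype, θ' q = 0} x', K ∙ x'] i).map
        (ExteriorAlgebra.map V₁.subtype).toLinearMap) =
      ![span (L₁ : Set V) (factorForms L₁ V₂) (ExteriorAlgebra.map V₁.subtype x'),
        span₁ (L₁ : Set V) (factorForms L₁ V₂) (ExteriorAlgebra.map V₁.subtype x'), K ∙ ExteriorAlgebra.map V₁.subtype x'] := by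
    funext i
    fin_cases i
    · exact (span_map_eq hV hL₁ x').symm
    · exact (span₁_map_eq hV hL₁ x').symm
    · exact (span_singleton_map_eq x').symm
  rw [e] at h'
  exact ⟨h', (h'.comp (f := ![(2 : Fin 3), 1, 0]) (by decide)).mono fun i => by fin_cases i <;> exact le_rfl⟩

/-- **THE KÜNNETH COUNT WITH INTRINSIC FACTOR DATA (th-7 FORMULA-N §N.3, literal contraction frame).** Over `V = V₁ ⊕ V₂`
(finite-dimensional) with `Lᵢ ⊆ Vᵢ`, let `xᵢ' ∈ Λ^{even} Vᵢ` be factor classes whose three intrinsic spans are independent.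
Then the contraction span of `Λι x₁' ∧ Λι x₂'` with respect to `(L₁ ⊕ L₂, (L₁ ⊕ L₂)^⊥)` has dimension
`r₂(x₁')·r₀(x₂') + r₁(x₁')·r₁(x₂') + r₀(x₁')·r₂(x₂')`, every `rₖ` computed in the factor's own exterior algebra.
[cite: BourbakiAlgebre1a3, Ch. III §7 no. 7 and §11 no. 9] -/
theorem finrank_span_map_mul_map [FiniteDimensional K V] (hV : IsCompl V₁ V₂) (hL₁ : L₁ ≤ V₁) (hL₂ : L₂ ≤ V₂)
    {x₁' : ExteriorAlgebra K V₁} {x₂' : ExteriorAlgebra K V₂} (hx₁' : x₁' ∈ evenFactorAlg (⊤ : Submodule K V₁))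
    (hx₂' : x₂' ∈ evenFactorAlg (⊤ : Submodule K V₂))
    (h₁ : iSupIndep ![span ((L₁.comap V₁.subtype : Submodule K V₁) : Set V₁)
        {θ' : Module.Dual K V₁ | ∀ q ∈ L₁.comap V₁.subtype, θ' q = 0} x₁',
      span₁ ((L₁.comap V₁.subtype : Submodule K V₁) : Set V₁)
        {θ' : Module.Dual K V₁ | ∀ q ∈ L₁.comap V₁.subtype, θ' q = 0} x₁', K ∙ x₁'])
    (h₂ : iSupIndep ![span ((L₂.comap V₂.subtype : Submodule K V₂) : Set V₂)
        {θ' : Module.Dual K V₂ | ∀ q ∈ L₂.comap V₂.subtype, θ' q = 0} x₂',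
      span₁ ((L₂.comap V₂.subtype : Submodule K V₂) : Set V₂)
        {θ' : Module.Dual K V₂ | ∀ q ∈ L₂.comap V₂.subtype, θ' q = 0} x₂', K ∙ x₂']) :
    Module.finrank K (span ((L₁ ⊔ L₂ : Submodule K V) : Set V) {θ : Module.Dual K V | ∀ q ∈ L₁ ⊔ L₂, θ q = 0}
      (ExteriorAlgebra.map V₁.subtype x₁' * ExteriorAlgebra.map V₂.subtype x₂')) =
      Module.finrank K (span ((L₁.comap V₁.subtype : Submodule K V₁) : Set V₁)
          {θ' : Module.Dual K V₁ | ∀ q ∈ L₁.comap V₁.subtype, θ' q = 0} x₁') * Module.finrank K (K ∙ x₂') +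
        Module.finrank K (span₁ ((L₁.comap V₁.subtype : Submodule K V₁) : Set V₁)
          {θ' : Module.Dual K V₁ | ∀ q ∈ L₁.comap V₁.subtype, θ' q = 0} x₁') *
          Module.finrank K (span₁ ((L₂.comap V₂.subtype : Submodule K V₂) : Set V₂)
          {θ' : Module.Dual K V₂ | ∀ q ∈ L₂.comap V₂.subtype, θ' q = 0} x₂') +
        Module.finrank K (K ∙ x₁') * Module.finrank K (span ((L₂.comap V₂.subtype : Submodule K V₂) : Set V₂)
          {θ' : Module.Dual K V₂ | ∀ q ∈ L₂.comap V₂.subtype, θ' q = 0} x₂') := by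
  rw [finrank_span_mul_eq hV hL₁ hL₂ (map_mem_evenFactorAlg_of_mem hx₁') (map_mem_evenFactorAlg_of_mem hx₂')
      (iSupIndep_spans_map hV hL₁ x₁' h₁).1 (iSupIndep_spans_map hV.symm hL₂ x₂' h₂).2,
    finrank_span_map_eq hV hL₁, finrank_span_singleton_map_eq, finrank_span₁_map_eq hV hL₁,
    finrank_span₁_map_eq hV.symm hL₂, finrank_span_singleton_map_eq, finrank_span_map_eq hV.symm hL₂]

end Factors

end ContractionSpan

/-! ### The real carriers -/

section Real

open Literature.AlgebraicGeometry.Motives Literature.AlgebraicGeometry.HodgeTheory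

variable {A : AbelianVariety ℂ} {V₁ V₂ L₁ L₂ : Submodule ℂ (complexBetti A.X 1)}

/-- **`contractionRank` of a BOX class with intrinsic factor data.** For an abelian variety `A/ℂ` with a presentation `hA`,
BY-VALUE binders `H¹(A) = V₁ ⊕ V₂`, `H^{0,1}(A) = L₁ ⊕ L₂` (`Lᵢ ⊆ Vᵢ`), and total class `Λι x₁' ∧ Λι x₂'` for intrinsically
even factor classes `xᵢ' ∈ Λ Vᵢ` with independent intrinsic spans (e.g. `ch(E₁ ⊠ E₂)` read in `Λ H¹(X × X′)`, th-7 §N.5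
dictionary; the tree has no product-of-abelian-varieties Künneth): `contractionRank A κ = r₂(x₁')·r₀(x₂') + r₁(x₁')·r₁(x₂')
+ r₀(x₁')·r₂(x₂')` with intrinsic `rₖ`. [cite: BuchweitzFlenner2008HH, Prop. 6.4.4] [cite: MumfordAV1970, §1 (4) and §4 (iii)] -/
theorem contractionRank_box (hA : IsSmoothProjective A.dim A.X) (κ : ∀ p : ℕ, complexBetti A.X (2 * p))
    (hV : IsCompl V₁ V₂) (hL : hodgeZeroOne hA = L₁ ⊔ L₂) (hL₁ : L₁ ≤ V₁) (hL₂ : L₂ ≤ V₂)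
    {x₁' : ExteriorAlgebra ℂ V₁} {x₂' : ExteriorAlgebra ℂ V₂}
    (hx₁' : x₁' ∈ ContractionSpan.evenFactorAlg (⊤ : Submodule ℂ V₁))
    (hx₂' : x₂' ∈ ContractionSpan.evenFactorAlg (⊤ : Submodule ℂ V₂))
    (h₁ : iSupIndep ![ContractionSpan.span ((L₁.comap V₁.subtype : Submodule ℂ V₁) : Set V₁)
        {θ' : Module.Dual ℂ V₁ | ∀ q ∈ L₁.comap V₁.subtype, θ' q = 0} x₁',
      ContractionSpan.span₁ ((L₁.comap V₁.subtype : Submodule ℂ V₁) : Set V₁)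
        {θ' : Module.Dual ℂ V₁ | ∀ q ∈ L₁.comap V₁.subtype, θ' q = 0} x₁', ℂ ∙ x₁'])
    (h₂ : iSupIndep ![ContractionSpan.span ((L₂.comap V₂.subtype : Submodule ℂ V₂) : Set V₂)
        {θ' : Module.Dual ℂ V₂ | ∀ q ∈ L₂.comap V₂.subtype, θ' q = 0} x₂',
      ContractionSpan.span₁ ((L₂.comap V₂.subtype : Submodule ℂ V₂) : Set V₂)
        {θ' : Module.Dual ℂ V₂ | ∀ q ∈ L₂.comap V₂.subtype, θ' q = 0} x₂', ℂ ∙ x₂'])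
    (hx : totalExteriorClass A κ = ExteriorAlgebra.map V₁.subtype x₁' * ExteriorAlgebra.map V₂.subtype x₂') :
    contractionRank A κ =
      ((Module.finrank ℂ (ContractionSpan.span ((L₁.comap V₁.subtype : Submodule ℂ V₁) : Set V₁)
          {θ' : Module.Dual ℂ V₁ | ∀ q ∈ L₁.comap V₁.subtype, θ' q = 0} x₁') * Module.finrank ℂ (ℂ ∙ x₂') +
        Module.finrank ℂ (ContractionSpan.span₁ ((L₁.comap V₁.subtype : Submodule ℂ V₁) : Set V₁)
          {θ' : Module.Dual ℂ V₁ | ∀ q ∈ L₁.comap V₁.subtype, θ' q = 0} x₁') *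
          Module.finrank ℂ (ContractionSpan.span₁ ((L₂.comap V₂.subtype : Submodule ℂ V₂) : Set V₂)
          {θ' : Module.Dual ℂ V₂ | ∀ q ∈ L₂.comap V₂.subtype, θ' q = 0} x₂') +
        Module.finrank ℂ (ℂ ∙ x₁') * Module.finrank ℂ (ContractionSpan.span ((L₂.comap V₂.subtype : Submodule ℂ V₂) : Set V₂)
          {θ' : Module.Dual ℂ V₂ | ∀ q ∈ L₂.comap V₂.subtype, θ' q = 0} x₂') : ℕ) : Cardinal) := by
  haveI : Module.Finite ℂ (complexBetti A.X 1) := abelianVarietyCohomologyExteriorH1_holds.finite_one A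
  rw [contractionRank_eq_finrank_span, hx, vectorFieldSet_eq A hA rfl, ← coe_hodgeZeroOne_eq_hodgeZeroOneSet A hA rfl]
  rw [hL]
  rw [ContractionSpan.finrank_span_map_mul_map hV hL₁ hL₂ hx₁' hx₂' h₁ h₂]

end Real

end Summit.Ventures.HSemireg

end
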